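import Summits.BirchSwinnertonDyer.BirchSwinnertonDyer.Theorems.AlignedTransportAtTwoMainConjectureOfRankZeroBSDAtTwoHalfDescentLayerIndexCertificateSelmer
import HarnessLib

/-!
# Route `AlignedTransportAtTwo`, crux C2 `MainConjectureOfRankZeroBSDAtTwo` (stmt-BirchSwinnertonDyer-22298):
# THE DESCENT NUMBER WITHOUT GREENBERG 4.14, VI — THE CERTIFICATE AT FINITE LEVEL: `#(X/Ψ_n X) ∣ #(X/ω_{n+1} X) = #Sel_{p^∞}(E/K_∞)^{Γ_{n+1}}`, so
# `0 < #Sel_∞^{Γ_{n+1}} < p^{pⁿ(p−1)}` at ANY ONE layer ⟹ `μ(X(E/K_∞)) = 0`; and by Greenberg's Lemma 4.3 (tree, unconditional count)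
# `0 < #Sel_{p^∞}(E/K_{n+1}) · #ker g_{n+1} < p^{pⁿ(p−1)}` ⟹ `μ = 0` — a certificate made of FINITE-LEVEL orders only

HONEST FRAMING (cell `bsd-f1-sign2`, WIDTH-5 attached prover seat `bsd-line-att-p5` gen 55 on line `birth` of the lead `bsd-line-att-p2`;
`--supports` stmt-BirchSwinnertonDyer-22298, closes nothing; BSD is NOT proved by any of this; the crux C2, its verdict «blocked-on
`Rank1Residual.GreenbergMuConjectureIrreducible`» and every registered stub (P / T / Kμ / LimDoor / MuIneqʳ / PFμ⁺) are untouched). THEOREMS ONLY — no `def`,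
no instance, no named fact, no `sorry`. Route-independent (any number field `K`, any `ℤ_p`-extension). Sequel of `…HalfDescentLayerIndexCertificate{,Selmer}`
(this gen: `0 < #(X/Ψ_nX) < p^{pⁿ(p−1)} ⟹ μ(X) = 0` for EVERY f.g. torsion `X`, and its `ker N_n`-form) composed with g54's `…HalfDescentLayerIndexSelmer`
(`#(X/ω_nX) = #Sel_∞^{Γ_n}`) and the tree's control count `WeierstrassCurve.natCard_selmerInvariants_mul_natCard_ker_layerToInfty`
(`#Sel_∞^{Γ_n} · #ker h_n = #Sel_{p^∞}(E/K_n) · #ker g_n`, Greenberg's Lemma 4.3, unconditional as a `Nat.card` identity).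

THE POINT. `Ψ_n ∣ ω_{n+1} = ω_n Ψ_n`, so `X/Ψ_n X` is a quotient of `X/ω_{n+1} X` and `#(X/Ψ_n X) ∣ #(X/ω_{n+1} X)`: an upper bound on the number of
`Γ_{n+1}`-INVARIANTS of the limit Selmer group bounds the relative-norm kernel, and the invariants are controlled by the Selmer group OVER `K_{n+1}`.
* §1 (any commutative ring) `natCard_quotient_smul_top_dvd_of_dvd`: `a ∣ b ⟹ #(M/aM) ∣ #(M/bM)` (`Nat.card`).
* §2 (pure `Λ`; `X` ANY f.g. torsion) ★★ `muInvariant_eq_zero_of_natCard_quotient_omega_succ_pos_lt`: **`0 < #(X/ω_{n+1}X) < p^{pⁿ(p−1)} ⟹ μ(X) = 0`**.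
* §3 (Selmer) ★★★ `mu_eq_zero_of_natCard_selmerInvariants_pos_lt`: **`0 < #Sel_{p^∞}(E/K_∞)^{Γ_{n+1}} < p^{pⁿ(p−1)}` at ANY ONE `n` ⟹ `μ(X(E/K_∞)) = 0`**;
  ★★★ `mu_eq_zero_of_natCard_selmerLayer_mul_kerG_pos_lt`: **`0 < #Sel_{p^∞}(E/K_{n+1}) · #ker g_{n+1} < p^{pⁿ(p−1)}` ⟹ `μ = 0`** (`ker g_m = A_m/Sel_m`, Greenberg's
  control kernel, finite and locally bounded by Lemma 3.3); `…_fixedPoints` form: with `E(K_∞)[p^∞]` finite the sharper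
  **`0 < #Sel_{p^∞}(E/K_{n+1}) · #ker g_{n+1} < p^{pⁿ(p−1)} · #E[p^∞]^{Gal(K̄/K_{n+1})}` ⟹ `μ = 0`**.
Reading for C2 (`p = 2`, `W/ℚ`, cyclotomic tower `ℚ_m = ℚ(ζ_{2^{m+2}})⁺`): `μ₂(X(W/ℚ_∞)) = 0` — the seed's only non-print input — is certified by the single
inequality `#Sel_{2^∞}(W/ℚ_{n+1}) · #ker g_{n+1} < 2^{2ⁿ}` at any one layer (sequel `…HalfDescentLayerIndexCertificateSeed` composes with the seed). What is NOT
claimed: no such number is computed here for any curve; the invariants form is weaker per layer than the `ker N_n` form of files IV–V (`#Sel_∞^{Γ_{n+1}} ≈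
2^{λ(n+1)+ν}` vs `#ker N_n ≈ 2^{λ}`), so it needs a higher layer. Memo `Cruxes/MainConjectureOfRankZeroBSDAtTwo/LAYER-INDEX-FINITE-att-p5-g55.md`.

References: R. Greenberg, LNM 1716 (1999), §1 pp. 60–65, §3 Lemmas 3.1–3.3, §4 Lemma 4.3 (p. 103), Conj. 1.11 [GreenbergLNM1716]; B. Mazur, Invent. Math. 18
(1972) §6 [Mazur1972]; L. Washington, GTM 83, §13.3 Thm. 13.13 [Washington1997].
-/

set_option linter.dupNamespace false
set_option autoImplicit false

noncomputable section

open scoped Classical AddSubgroup Polynomial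

universe u

namespace Summit.BirchSwinnertonDyer.BirchSwinnertonDyer.Theorems.AlignedTransportAtTwoHalfDescentLayerIndexCertificateLayer

open WeierstrassCurve Literature.NumberTheory.EllipticCurves Literature.NumberTheory.EllipticCurves.IwasawaDual
  Literature.NumberTheory.EllipticCurves.IwasawaAlgebra
  Summit.BirchSwinnertonDyer.Rank1Residual.X1.MuLambda
  Summit.BirchSwinnertonDyer.Rank1Residual.X1.GeneratorBoundMu
  Summit.BirchSwinnertonDyer.Rank1Residual.Iwasawa
  Summit.BirchSwinnertonDyer.BirchSwinnertonDyer.Theorems.DefectPrime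
  Summit.BirchSwinnertonDyer.BirchSwinnertonDyer.Theorems.AlignedTransportAtTwoCyclotomicLayerPrime
  Summit.BirchSwinnertonDyer.BirchSwinnertonDyer.Theorems.AlignedTransportAtTwoHalfDescentLayerIndex
  Summit.BirchSwinnertonDyer.BirchSwinnertonDyer.Theorems.AlignedTransportAtTwoHalfDescentLayerIndexSelmer
  Summit.BirchSwinnertonDyer.BirchSwinnertonDyer.Theorems.AlignedTransportAtTwoHalfDescentLayerIndexCertificate
  Summit.BirchSwinnertonDyer.BirchSwinnertonDyer.Theorems.AlignedTransportAtTwoHalfDescentLayerIndexCertificateSelmer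

/-! ## §1 `a ∣ b ⟹ #(M/aM) ∣ #(M/bM)` -/

section Ring

variable {R : Type*} [CommRing R] {M : Type*} [AddCommGroup M] [Module R M]

/-- **`a ∣ b ⟹ #(M/aM) ∣ #(M/bM)`** (`bM ⊆ aM`, so `M/aM` is a quotient of `M/bM`; `Nat.card`, valid verbatim when a quotient is infinite). [folklore] -/
theorem natCard_quotient_smul_top_dvd_of_dvd {a b : R} (hab : a ∣ b) :
    Nat.card (M ⧸ (Ideal.span {a} • ⊤ : Submodule R M)) ∣ Nat.card (M ⧸ (Ideal.span {b} • ⊤ : Submodule R M)) := by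
  set A : Submodule R M := Ideal.span {a} • ⊤ with hA
  set B : Submodule R M := Ideal.span {b} • ⊤ with hB
  have hBA : B ≤ A := Submodule.smul_mono_left (Ideal.span_singleton_le_span_singleton.mpr hab)
  rw [Submodule.card_eq_card_quotient_mul_card (A.map B.mkQ), Nat.card_congr (Submodule.quotientQuotientEquivQuotient B A hBA).toEquiv]
  exact Dvd.intro_left _ rfl

end Ring

/-! ## §2 `0 < #(X/ω_{n+1} X) < p^{pⁿ(p−1)} ⟹ μ(X) = 0` -/

section Module

variable {p : ℕ} [hp : Fact p.Prime] {M : Type u} [AddCommGroup M] [Module (IwasawaAlgebra p) M]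

/-- **`#(X/Ψ_n X) ∣ #(X/ω_{n+1} X)`** (`ω_{n+1} = Ψ_n · ω_n`). [cite: Washington1997, §13.2 and §13.3 (Lemma 13.18)] -/
theorem natCard_layerQuotient_dvd_natCard_quotient_omega_succ (n : ℕ) :
    Nat.card (M ⧸ (Ideal.span {(((Polynomial.cyclotomic (p ^ (n + 1)) ℤ_[p]).comp (Polynomial.X + 1) : ℤ_[p][X]) : IwasawaAlgebra p)} • ⊤ :
      Submodule (IwasawaAlgebra p) M)) ∣
      Nat.card (M ⧸ (Ideal.span {((1 + PowerSeries.X : PowerSeries ℤ_[p]) ^ (p ^ (n + 1)) - 1 : IwasawaAlgebra p)} • ⊤ : Submodule (IwasawaAlgebra p) M)) := by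
  apply natCard_quotient_smul_top_dvd_of_dvd
  rw [← coe_cyclotomicLayer_mul_omega p n]
  exact Dvd.intro _ rfl

/-- ★★ **`0 < #(X/ω_{n+1} X) < p^{pⁿ(p−1)} ⟹ μ(X) = 0`** for EVERY finitely generated torsion `Λ`-module `X` and ANY `n` (`X/Ψ_nX` is a quotient of `X/ω_{n+1}X`,
then `…Certificate.muInvariant_eq_zero_of_natCard_layerQuotient_pos_lt`). [cite: Washington1997, §13.3 Thm. 13.13] [cite: GreenbergLNM1716, Conj. 1.11] -/
theorem muInvariant_eq_zero_of_natCard_quotient_omega_succ_pos_lt [Module.Finite (IwasawaAlgebra p) M] (hM : Module.IsTorsion (IwasawaAlgebra p) M)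
    {n : ℕ} (hpos : 0 < Nat.card (M ⧸ (Ideal.span {((1 + PowerSeries.X : PowerSeries ℤ_[p]) ^ (p ^ (n + 1)) - 1 : IwasawaAlgebra p)} • ⊤ :
      Submodule (IwasawaAlgebra p) M)))
    (hlt : Nat.card (M ⧸ (Ideal.span {((1 + PowerSeries.X : PowerSeries ℤ_[p]) ^ (p ^ (n + 1)) - 1 : IwasawaAlgebra p)} • ⊤ :
      Submodule (IwasawaAlgebra p) M)) < p ^ (p ^ n * (p - 1))) : muInvariant p M = 0 := by
  have hdvd := natCard_layerQuotient_dvd_natCard_quotient_omega_succ (p := p) (M := M) n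
  have hpos' : 0 < Nat.card (M ⧸ (Ideal.span {(((Polynomial.cyclotomic (p ^ (n + 1)) ℤ_[p]).comp (Polynomial.X + 1) : ℤ_[p][X]) : IwasawaAlgebra p)} • ⊤ :
      Submodule (IwasawaAlgebra p) M)) := by
    refine Nat.pos_of_ne_zero fun h0 ↦ ?_
    rw [h0, zero_dvd_iff] at hdvd
    omega
  exact muInvariant_eq_zero_of_natCard_layerQuotient_pos_lt hM hpos' ((Nat.le_of_dvd hpos hdvd).trans_lt hlt)

end Module

/-! ## §3 Selmer currency and finite level -/

section Selmer

variable {K : Type u} [Field K] [NumberField K] (W : WeierstrassCurve K) {p : ℕ} [hp : Fact p.Prime] (κ : ZpExtension K p)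
  {γ : Field.absoluteGaloisGroup K}

/-- ★★★ **`μ(X(E/K_∞)) = 0` FROM FEW INVARIANTS AT ONE LAYER.** `E/K`, `κ` any `ℤ_p`-extension with topological generator `γ`, `D` any Pontryagin-dual datum with `X`
finitely generated torsion. If at SOME `n`: **`0 < #Sel_{p^∞}(E/K_∞)^{Γ_{n+1}} < p^{pⁿ(p−1)}`**, then **`μ(X) = 0`** (`#(X/ω_{n+1}X) = #Sel_∞^{Γ_{n+1}}`, g40/g54).
[cite: GreenbergLNM1716, §1 pp. 60–65 and Conj. 1.11] [cite: Washington1997, §13.3 Thm. 13.13, §13.4] -/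
theorem mu_eq_zero_of_natCard_selmerInvariants_pos_lt (hγ : κ.IsTopGenerator γ) (D : W.SelmerDualData κ γ) [Module.Finite (IwasawaAlgebra p) D.X]
    (hD : D.IsTorsion) {n : ℕ} (hpos : 0 < Nat.card ↥(W.selmerInfty κ ⊓ W.layerInvariants κ (n + 1)))
    (hlt : Nat.card ↥(W.selmerInfty κ ⊓ W.layerInvariants κ (n + 1)) < p ^ (p ^ n * (p - 1))) : D.mu = 0 := by
  rw [← natCard_layerQuotient_omega_eq_natCard_selmerInvariants W κ hγ D (n + 1)] at hpos hlt
  exact muInvariant_eq_zero_of_natCard_quotient_omega_succ_pos_lt (M := D.X) hD hpos hlt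

/-- ★★★ **`μ = 0` FROM FINITE-LEVEL ORDERS ONLY.** Same setting; `Sel_m = Sel_{p^∞}(E/K_m)`, `ker g_m = A_m/Sel_m` Greenberg's control kernel (tree `KerG`). If at SOME
`n`: **`0 < #Sel_{p^∞}(E/K_{n+1}) · #ker g_{n+1} < p^{pⁿ(p−1)}`**, then **`μ(X(E/K_∞)) = 0`** (Lemma 4.3: `#Sel_∞^{Γ_m} · #ker h_m = #Sel_m · #ker g_m`, so the invariants
are positive and at most the left side). [cite: GreenbergLNM1716, §4 Lemma 4.3 (p. 103), §3 Lemmas 3.1–3.3, Conj. 1.11] [cite: Mazur1972, §6] -/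
theorem mu_eq_zero_of_natCard_selmerLayer_mul_kerG_pos_lt (hγ : κ.IsTopGenerator γ) (D : W.SelmerDualData κ γ) [Module.Finite (IwasawaAlgebra p) D.X]
    (hD : D.IsTorsion) {n : ℕ} (hpos : 0 < Nat.card ↥(W.selmerLayer κ (n + 1)) * Nat.card (W.KerG κ (n + 1)))
    (hlt : Nat.card ↥(W.selmerLayer κ (n + 1)) * Nat.card (W.KerG κ (n + 1)) < p ^ (p ^ n * (p - 1))) : D.mu = 0 := by
  have h43 := W.natCard_selmerInvariants_mul_natCard_ker_layerToInfty κ (n + 1)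
  have hinv_pos : 0 < Nat.card ↥(W.selmerInfty κ ⊓ W.layerInvariants κ (n + 1)) := by
    refine Nat.pos_of_ne_zero fun h0 ↦ ?_
    rw [h0, zero_mul] at h43
    omega
  have hker_pos : 0 < Nat.card (W.layerToInfty κ (n + 1)).ker := by
    refine Nat.pos_of_ne_zero fun h0 ↦ ?_
    rw [h0, mul_zero] at h43
    omega
  have hle : Nat.card ↥(W.selmerInfty κ ⊓ W.layerInvariants κ (n + 1)) ≤ Nat.card ↥(W.selmerLayer κ (n + 1)) * Nat.card (W.KerG κ (n + 1)) := by
    rw [← h43]; exact Nat.le_mul_of_pos_right _ hker_pos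
  exact mu_eq_zero_of_natCard_selmerInvariants_pos_lt W κ hγ D hD hinv_pos (hle.trans_lt hlt)

/-- The sharper form with the torsion kernel counted: when `E(K_∞)[p^∞]` is finite, `#ker h_m = #E[p^∞]^{Gal(K̄/K_m)}` (tree), and
**`0 < #Sel_{p^∞}(E/K_{n+1}) · #ker g_{n+1} < p^{pⁿ(p−1)} · #E[p^∞]^{Gal(K̄/K_{n+1})}` ⟹ `μ(X(E/K_∞)) = 0`**. [cite: GreenbergLNM1716, §4 Lemma 4.3 (p. 103)] -/
theorem mu_eq_zero_of_natCard_selmerLayer_mul_kerG_pos_lt_fixedPoints (hγ : κ.IsTopGenerator γ) (D : W.SelmerDualData κ γ)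
    [Module.Finite (IwasawaAlgebra p) D.X] [Finite (FixedPoints.addSubgroup κ.kerSubgroup (geomPrimaryTorsion W p))] (hD : D.IsTorsion) {n : ℕ}
    (hpos : 0 < Nat.card ↥(W.selmerLayer κ (n + 1)) * Nat.card (W.KerG κ (n + 1)))
    (hlt : Nat.card ↥(W.selmerLayer κ (n + 1)) * Nat.card (W.KerG κ (n + 1)) <
      p ^ (p ^ n * (p - 1)) * Nat.card {m : geomPrimaryTorsion W p | ∀ σ ∈ κ.layerSubgroup (n + 1), σ • m = m}) : D.mu = 0 := by
  have h43 := W.natCard_selmerInvariants_mul_natCard_ker_layerToInfty κ (n + 1)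
  rw [W.natCard_ker_layerToInfty_eq_natCard_fixedPoints κ (n + 1)] at h43
  have hinv_pos : 0 < Nat.card ↥(W.selmerInfty κ ⊓ W.layerInvariants κ (n + 1)) := by
    refine Nat.pos_of_ne_zero fun h0 ↦ ?_
    rw [h0, zero_mul] at h43
    omega
  have hfix_pos : 0 < Nat.card {m : geomPrimaryTorsion W p | ∀ σ ∈ κ.layerSubgroup (n + 1), σ • m = m} := by
    refine Nat.pos_of_ne_zero fun h0 ↦ ?_
    rw [h0, mul_zero] at h43
    omega
  rw [← h43] at hlt
  exact mu_eq_zero_of_natCard_selmerInvariants_pos_lt W κ hγ D hD hinv_pos (Nat.lt_of_mul_lt_mul_right hlt)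

end Selmer

end Summit.BirchSwinnertonDyer.BirchSwinnertonDyer.Theorems.AlignedTransportAtTwoHalfDescentLayerIndexCertificateLayer

end
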